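import Literature.Probability.RandomPlanarGeometry.SAWTriangularUnfolding
import Literature.Probability.RandomPlanarGeometry.SAWTriangularBridgeGrowth
import Literature.Probability.RandomPlanarGeometry.SAWTriangularWindow
import Mathlib.Analysis.Complex.ExponentialBounds
import HarnessLib

/-!
# The Hammersley–Welsh bound on the triangular lattice: `c_N(𝕋) ≤ e^{K√N} μ(𝕋)^N`

Topic `Literature/Probability/RandomPlanarGeometry` (end of the chain `SAWTriangularBrickWalks` →
`SAWTriangularBridges` → `SAWTriangularUnfolding` → `SAWTriangularBridgeGrowth`). Sources: J. M. Hammersley,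
D. J. A. Welsh, *Further results on the rate of convergence to the connective constant of the hypercubical
lattice*, Quart. J. Math. Oxford 13 (1962) 108–110, and N. Madras, G. Slade, *The Self-Avoiding Walk*
(1993), Theorem 3.1.1 with its proof, (3.1.7) — there for `ℤ^d`; for a general (quasi-)transitive graph
with a unimodular graph height function the same statement is PRINTED as G. Grimmett, Z. Li, *Locality of
connective constants*, Discrete Math. 341 (2018) 3483–3497, §7, Proposition ("`σ_n ≤ B n³ e^{B√n} βⁿ`,
`n ≥ 1`") together with Theorem 4.3 ("`β = μ`"), and as C. Lindorfer, *A general bridge theorem for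
self-avoiding walks*, Discrete Math. 343 (2020) 112092, Lemma 3.5 ("Let `C > π√(2d/3)`. Then there is an
integer `N` such that for all `n ≥ N`, `c_n ≤ e^{C√(n+1)} β_max^{n+1}`"). The triangular lattice with
the brick height `X = 2x₀ + x₁` (translations of `ℤ²`, step bound `d = 2`) is an instance of both; this
file is the kernel proof of that instance, with an explicit elementary constant (`K = 15`, all `N ≥ 1`)
in place of the Hardy–Ramanujan constant.

## Contents (namespace `Literature.Probability.RandomPlanarGeometry.SAW`)

* `triSawCount_le_mul_exp_mul_brickBridgeCount` — `c_n(𝕋) ≤ (n+1) e^{6√(2(n+1))} b_{n+1}(𝕋)`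
  (M–S (3.1.7): split at the last minimum of the height into two half-space walks, unfold each into
  a bridge at most `e^{3√(2·)}`-to-one, concatenate);
* `triSawCount_le_mul_exp_mul_pow` — the same with `b_{n+1} ≤ μ(𝕋)^{n+1}`;
* **`triSawCount_le_exp_mul_pow` : `∀ N ≥ 1, c_N(𝕋) ≤ e^{15√N} μ(𝕋)^N`** and the lane face
  **`triHW : ∃ K, ∀ N ≥ 1, c_N(𝕋) ≤ e^{K√N} μ(𝕋)^N`** (`μ(𝕋) = exp logMuTri`).
-/

noncomputable section

open Finset Literature.Probability.LatticeModels Literature.Probability.Percolation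
open scoped BigOperators

namespace Literature.Probability.RandomPlanarGeometry.SAW

/-- **`c_n(𝕋) ≤ (n+1) e^{6√(2(n+1))} b_{n+1}(𝕋)`** (Madras–Slade (3.1.7) on `𝕋`, explicit constants):
split at the last minimum of the height into two half-space walks, unfold each into a bridge
(`≤ e^{3√(2·)}`-to-one), and concatenate the two bridges.
[cite: MadrasSlade1993, §3.1, proof of Theorem 3.1.1 (p. 57), eq. (3.1.7) (pp. 59–60)] -/
theorem triSawCount_le_mul_exp_mul_brickBridgeCount (n : ℕ) :
    (triSawCount n : ℝ) ≤
      (n + 1) * Real.exp (6 * Real.sqrt (2 * (n + 1))) * brickBridgeCount (n + 1) := by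
  have h1 : (triSawCount n : ℝ) ≤
      ∑ m ∈ Finset.range (n + 1), (brickHalfSpaceCount (m + 1) : ℝ) * brickHalfSpaceCount (n - m) := by
    exact_mod_cast triSawCount_le_sum_brickHalfSpaceCount n
  refine h1.trans ?_
  have hterm : ∀ m ∈ Finset.range (n + 1),
      (brickHalfSpaceCount (m + 1) : ℝ) * brickHalfSpaceCount (n - m) ≤
        Real.exp (6 * Real.sqrt (2 * (n + 1))) * brickBridgeCount (n + 1) := by
    intro m hm
    rw [Finset.mem_range] at hm
    have ha := brickHalfSpaceCount_le_exp_mul_brickBridgeCount (m + 1)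
    have hb := brickHalfSpaceCount_le_exp_mul_brickBridgeCount (n - m)
    have hmn : (m : ℝ) ≤ n := by exact_mod_cast Nat.le_of_lt_succ hm
    have hsa : Real.sqrt (2 * ((m + 1 : ℕ) : ℝ)) ≤ Real.sqrt (2 * (n + 1)) :=
      Real.sqrt_le_sqrt (by push_cast; linarith)
    have hsb : Real.sqrt (2 * ((n - m : ℕ) : ℝ)) ≤ Real.sqrt (2 * (n + 1)) :=
      Real.sqrt_le_sqrt (by
        have : ((n - m : ℕ) : ℝ) ≤ n := by exact_mod_cast Nat.sub_le n m
        linarith)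
    have hea : Real.exp (3 * Real.sqrt (2 * ((m + 1 : ℕ) : ℝ))) ≤ Real.exp (3 * Real.sqrt (2 * (n + 1))) :=
      Real.exp_le_exp.2 (by linarith)
    have heb : Real.exp (3 * Real.sqrt (2 * ((n - m : ℕ) : ℝ))) ≤ Real.exp (3 * Real.sqrt (2 * (n + 1))) :=
      Real.exp_le_exp.2 (by linarith)
    have hbb : (brickBridgeCount (m + 1) : ℝ) * brickBridgeCount (n - m) ≤ brickBridgeCount (n + 1) := by
      have := brickBridgeCount_mul_le (m + 1) (n - m)
      rw [show m + 1 + (n - m) = n + 1 by omega] at this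
      exact_mod_cast this
    have h0a : (0 : ℝ) ≤ brickBridgeCount (m + 1) := Nat.cast_nonneg _
    have h0b : (0 : ℝ) ≤ brickBridgeCount (n - m) := Nat.cast_nonneg _
    calc (brickHalfSpaceCount (m + 1) : ℝ) * brickHalfSpaceCount (n - m)
        ≤ (Real.exp (3 * Real.sqrt (2 * ((m + 1 : ℕ) : ℝ))) * brickBridgeCount (m + 1)) *
            (Real.exp (3 * Real.sqrt (2 * ((n - m : ℕ) : ℝ))) * brickBridgeCount (n - m)) :=
          mul_le_mul ha hb (Nat.cast_nonneg _) (by positivity)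
      _ ≤ (Real.exp (3 * Real.sqrt (2 * (n + 1))) * brickBridgeCount (m + 1)) *
            (Real.exp (3 * Real.sqrt (2 * (n + 1))) * brickBridgeCount (n - m)) :=
          mul_le_mul (mul_le_mul_of_nonneg_right hea h0a) (mul_le_mul_of_nonneg_right heb h0b)
            (by positivity) (by positivity)
      _ = Real.exp (6 * Real.sqrt (2 * (n + 1))) *
            ((brickBridgeCount (m + 1) : ℝ) * brickBridgeCount (n - m)) := by
          rw [show (6 : ℝ) * Real.sqrt (2 * (n + 1)) =
            3 * Real.sqrt (2 * (n + 1)) + 3 * Real.sqrt (2 * (n + 1)) by ring, Real.exp_add]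
          ring
      _ ≤ Real.exp (6 * Real.sqrt (2 * (n + 1))) * brickBridgeCount (n + 1) :=
          mul_le_mul_of_nonneg_left hbb (Real.exp_nonneg _)
  calc ∑ m ∈ Finset.range (n + 1), (brickHalfSpaceCount (m + 1) : ℝ) * brickHalfSpaceCount (n - m)
      ≤ ∑ _m ∈ Finset.range (n + 1), Real.exp (6 * Real.sqrt (2 * (n + 1))) * brickBridgeCount (n + 1) :=
        Finset.sum_le_sum hterm
    _ = (n + 1) * Real.exp (6 * Real.sqrt (2 * (n + 1))) * brickBridgeCount (n + 1) := by
        rw [Finset.sum_const, Finset.card_range, nsmul_eq_mul]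
        push_cast
        ring

/-- **`c_n(𝕋) ≤ (n+1) e^{6√(2(n+1))} μ(𝕋)^{n+1}`** (`b_{n+1}(𝕋) ≤ μ(𝕋)^{n+1}`).
[cite: MadrasSlade1993, Theorem 3.1.1] -/
theorem triSawCount_le_mul_exp_mul_pow (n : ℕ) :
    (triSawCount n : ℝ) ≤
      (n + 1) * Real.exp (6 * Real.sqrt (2 * (n + 1))) * Real.exp logMuTri ^ (n + 1) :=
  (triSawCount_le_mul_exp_mul_brickBridgeCount n).trans
    (mul_le_mul_of_nonneg_left (brickBridgeCount_le_pow (n + 1)) (by positivity))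

/-- `log (N + 1) + log 5 ≤ 3 √N` for `N ≥ 1` (elementary: `log (N+1) = 2 log √(N+1) ≤ 2(√(N+1) − 1)`,
`√(N+1) ≤ √2 √N`, `log 5 ≤ 2`). [folklore] -/
private theorem log_add_one_add_log_five_le (N : ℕ) (hN : 1 ≤ N) :
    Real.log ((N : ℝ) + 1) + Real.log 5 ≤ 3 * Real.sqrt N := by
  have hN1 : (1 : ℝ) ≤ N := by exact_mod_cast hN
  have hs1 : 0 < Real.sqrt ((N : ℝ) + 1) := Real.sqrt_pos.2 (by linarith)
  -- `log (N+1) ≤ 2 (√(N+1) - 1)`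
  have hlog : Real.log ((N : ℝ) + 1) ≤ 2 * (Real.sqrt ((N : ℝ) + 1) - 1) := by
    have h := Real.log_le_sub_one_of_pos hs1
    have e : Real.log ((N : ℝ) + 1) = 2 * Real.log (Real.sqrt ((N : ℝ) + 1)) := by
      rw [Real.log_sqrt (by linarith)]
      ring
    rw [e]
    linarith
  -- `√(N+1) ≤ √2 · √N ≤ (3/2) √N`
  have hsq : Real.sqrt ((N : ℝ) + 1) ≤ Real.sqrt 2 * Real.sqrt N := by
    rw [← Real.sqrt_mul (by norm_num)]
    exact Real.sqrt_le_sqrt (by linarith)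
  have h2 : Real.sqrt 2 ≤ 3 / 2 := by
    rw [Real.sqrt_le_left (by norm_num)]
    norm_num
  have hsN : 1 ≤ Real.sqrt (N : ℝ) := by
    rw [show (1 : ℝ) = Real.sqrt 1 by simp]
    exact Real.sqrt_le_sqrt hN1
  have hlog5 : Real.log 5 ≤ 2 := by
    rw [Real.log_le_iff_le_exp (by norm_num)]
    have h1 := Real.exp_one_gt_d9
    have h' : Real.exp 1 * Real.exp 1 = Real.exp 2 := by rw [← Real.exp_add]; norm_num
    nlinarith [Real.exp_pos (1 : ℝ)]
  nlinarith [Real.sqrt_nonneg (N : ℝ)]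

/-- **The Hammersley–Welsh bound on `𝕋`, explicit: `c_N(𝕋) ≤ e^{15√N} μ(𝕋)^N` for every `N ≥ 1`**
(`(N+1) e^{6√(2N+2)} μ ≤ e^{15√N}` using `μ(𝕋) ≤ 5`, `√(2N+2) ≤ 2√N`, `log(N+1) + log 5 ≤ 3√N`).
[cite: MadrasSlade1993, Theorem 3.1.1] -/
theorem triSawCount_le_exp_mul_pow (N : ℕ) (hN : 1 ≤ N) :
    (triSawCount N : ℝ) ≤ Real.exp (15 * Real.sqrt N) * Real.exp logMuTri ^ N := by
  have hN1 : (1 : ℝ) ≤ N := by exact_mod_cast hN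
  set μ : ℝ := Real.exp logMuTri with hμ
  have hμpos : 0 < μ := Real.exp_pos _
  have hμ5 : μ ≤ 5 := by
    rw [hμ, ← Real.exp_log (show (0 : ℝ) < 5 by norm_num)]
    exact Real.exp_le_exp.2 logMuTri_le_log_five
  have h := triSawCount_le_mul_exp_mul_pow N
  refine h.trans ?_
  -- compare logarithms of the prefactors
  have hsq : Real.sqrt (2 * ((N : ℝ) + 1)) ≤ 2 * Real.sqrt N := by
    rw [show (2 : ℝ) * Real.sqrt N = Real.sqrt (4 * N) by
      rw [Real.sqrt_mul (by norm_num), show Real.sqrt (4 : ℝ) = 2 by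
        rw [show (4 : ℝ) = 2 ^ 2 by norm_num, Real.sqrt_sq (by norm_num)]]]
    exact Real.sqrt_le_sqrt (by linarith)
  have hlog := log_add_one_add_log_five_le N hN
  have hpre : ((N : ℝ) + 1) * Real.exp (6 * Real.sqrt (2 * ((N : ℝ) + 1))) * μ ≤
      Real.exp (15 * Real.sqrt N) := by
    have e1 : ((N : ℝ) + 1) = Real.exp (Real.log ((N : ℝ) + 1)) := (Real.exp_log (by linarith)).symm
    have e2 : μ ≤ Real.exp (Real.log 5) := by rwa [Real.exp_log (by norm_num)]
    calc ((N : ℝ) + 1) * Real.exp (6 * Real.sqrt (2 * ((N : ℝ) + 1))) * μ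
        ≤ Real.exp (Real.log ((N : ℝ) + 1)) * Real.exp (6 * Real.sqrt (2 * ((N : ℝ) + 1))) *
            Real.exp (Real.log 5) := by
          rw [← e1]
          exact mul_le_mul_of_nonneg_left e2 (by positivity)
      _ = Real.exp (Real.log ((N : ℝ) + 1) + 6 * Real.sqrt (2 * ((N : ℝ) + 1)) + Real.log 5) := by
          rw [Real.exp_add, Real.exp_add]
      _ ≤ Real.exp (15 * Real.sqrt N) := Real.exp_le_exp.2 (by linarith)
  calc ((N : ℝ) + 1) * Real.exp (6 * Real.sqrt (2 * ((N : ℝ) + 1))) * μ ^ (N + 1)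
      = (((N : ℝ) + 1) * Real.exp (6 * Real.sqrt (2 * ((N : ℝ) + 1))) * μ) * μ ^ N := by
        rw [pow_succ]; ring
    _ ≤ Real.exp (15 * Real.sqrt N) * μ ^ N :=
        mul_le_mul_of_nonneg_right hpre (pow_nonneg hμpos.le N)

/-- **The Hammersley–Welsh bound on the triangular lattice** (lane face «TRI-HW»): there is `K` with
`c_N(𝕋) ≤ e^{K√N} μ(𝕋)^N` for all `N ≥ 1` (`K = 15` by `triSawCount_le_exp_mul_pow`). Printed for `ℤ^d`
by Hammersley–Welsh / Madras–Slade Theorem 3.1.1; for graphs with a unimodular graph height function —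
of which `𝕋` with the brick height is one — by Grimmett–Li (Theorem 4.3 with §7) and Lindorfer
(Lemma 3.5). [cite: Lindorfer2020, Lemma 3.5] -/
theorem triHW : ∃ K : ℝ, ∀ N : ℕ, 1 ≤ N →
    (triSawCount N : ℝ) ≤ Real.exp (K * Real.sqrt N) * Real.exp logMuTri ^ N :=
  ⟨15, triSawCount_le_exp_mul_pow⟩

end Literature.Probability.RandomPlanarGeometry.SAW
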